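import Summits.BirchSwinnertonDyer.Rank1Residual.X11b.BDPRouteTamagawaSupport
import Literature.NumberTheory.EllipticCurves.QuadraticTwistLocalPolynomialProofs
import HarnessLib

/-!
# Class X11b, route "BDP + converse-theorem engine + Kolyvagin": the Shimura links' Tamagawa bookkeeping at an INERT multiplicative prime (cell `b2b-bsdres`, sub-cell `multr1-p2`, gen 9)

HONEST FRAMING (verbatim, cell `b2b-bsdres`): the goal of the cell is to DELETE the
COMBINATION-SHAPED residual classes for ALL analytic-rank `≤ 1` curves over `ℚ` — "full BSD
formula for every rank `≤ 1` curve in class `C`" assembled STRICTLY from published theorems — so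
that the rank-`≤ 1` remainder becomes exactly the CONSTRUCTION-SHAPED classes, which are TYPED
(missing-input Props), NOT attempted; this is not "finishing BSD". Research route `p2` for class
X11b; no claim beyond the stated class; nothing booked; X11b stays CONSTRUCTION-SHAPED. Theorems
only (no definition, no new named fact).

## What this file does

`X11b/BDPRouteUpperLinks.lean` (gen 9) derives the Euler-system half (T2) of `BSD(E,p)` from the
two Shimura-curve shapes of Jetchev–Skinner–Wan 2017 §7.4.2 at a quadratic field `K`, granted the
NUMERIC Tamagawa condition `ord_p ∏c(E) + ord_p ∏c(E^{d_K}) ≤ T`, `T` being the `N⁻`-term of the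
Gross–Zagier shape. This file PROVES that condition for the field of JSW §7.4.2 — the bad primes
of a finite set `S` ("`N⁻`") ODD, INERT in `K` (`(d_K/ℓ) = −1`) and multiplicative for `E`, every
other bad prime SPLIT (`d_K` a square in `ℚ_ℓ`), and every split multiplicative prime `ℓ ∉ S` of
`E` très ramifié (`p ∤ ord_ℓ Δ_min`) — with `T = Σ_{ℓ ∈ S} ord_p(ord_ℓ Δ_min(E))`, which is JSW's
`ord_p ∏_{ℓ ∣ N⁻} c_ℓ(E/K″)` (at an inert multiplicative place `c = ord_ℓ Δ`). Prime by prime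
(Kodaira–Néron, Silverman *ATAEC* IV.9.2; Tate's algorithm under a unit twist, *AEC* VII.5):

* `ℓ ∈ S` (odd, `(d_K/ℓ) = −1`, multiplicative): `d_K` is a non-square `ℓ`-adic unit, so EXACTLY ONE
  of `E`, `E^{d_K}` is split multiplicative at `ℓ` (`hasSplitMultiplicativeReduction_quadraticTwist_iff`),
  both with `ord_ℓ Δ_min(E)` (`padicValInt_minimalDiscriminantInt_twist_eq_of_jacobiSym`): the split
  one has `c_ℓ = ord_ℓ Δ_min(E)`, the other `c_ℓ ≤ 4` — contribution `ord_p(ord_ℓ Δ_min(E))`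
  (`padicValNat_localTamagawaNumber_add_twist_le_of_inert`);
* `ℓ ∣ N`, `ℓ ∉ S` (split): `E^{d_K} ≅ E` over `ℚ_ℓ`, `c_ℓ(E^{d_K}) = c_ℓ(E)`, and `p ∤ c_ℓ(E)`
  because `ℓ` is not split multiplicative with `p ∣ ord_ℓ Δ_min` (`localTamagawaNumber_twist_eq_of_isSquare`);
* `ℓ ∤ N`: `c_ℓ(E) = 1`, `E^{d_K}` good or additive at `ℓ`, `c_ℓ ≤ 4`.

This file (part 1 of 2) does the INERT prime: `padicValNat_localTamagawaNumber_add_twist_le_of_inert`, with the unit-twist discriminant lemma `padicValInt_minimalDiscriminantInt_twist_eq_of_jacobiSym` and the `ℓ`-adic unit / quadratic non-residue helpers; the split and good primes and the sum over all places are in `BDPRouteUpperLinksField.lean` (part 2), whose main theorem `padicValNat_tamagawaProduct_add_twist_le_of_inertSet`, combined with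
`missingUpperBoundAt_of_shimuraShapes` it leaves, on (T2β)∖(T2α), EXACTLY the two shapes (U-Sh),
(GZ-Sh) at such a field and the field's existence (Friedberg–Hoffstein with prescribed local
behaviour) as the untyped inputs of the upper half. CONDITIONAL theorems downstream; nothing
booked; labels unchanged. `ℓ = 2 ∈ S` is not treated (the unit-twist lemmas need `2 ∈ ℤ_ℓ^×`).

## References

* [SilvermanATAEC1994] Cor. IV.9.2 (b),(d) (PDF p. 340); [SilvermanAEC2009] VII.1 Prop. 1.3,
  VII.5 Prop. 5.1, X.5 Cor. 5.4; [JetchevSkinnerWan2017] §7.4.2 (p. 31), §7.3.1 (eq:tamK).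
-/

noncomputable section

open scoped Classical

open WeierstrassCurve NumberField IsDedekindDomain Literature.NumberTheory.EllipticCurves
  Rat.HeightOneSpectrum
  Literature.NumberTheory.EllipticCurves.Rank1Residual

namespace Summit.BirchSwinnertonDyer.Rank1Residual.X11b

/-! ### `ℓ`-adic units and quadratic (non-)residues -/

section Units

variable {ℓ : ℕ} [Fact ℓ.Prime]

/-- An integer prime to `ℓ` is a unit of `ℤ_ℓ`. [folklore] -/
theorem isUnit_intCast_padicInt_of_not_dvd {n : ℤ} (h : ¬ (ℓ : ℤ) ∣ n) : IsUnit ((n : ℤ_[ℓ])) := by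
  rw [PadicInt.isUnit_iff]
  exact le_antisymm (PadicInt.norm_le_one _)
    (not_lt.mp fun hlt ↦ h ((PadicInt.norm_int_lt_one_iff_dvd n).mp hlt))

/-- `2` is a unit of `ℤ_ℓ` for odd `ℓ`. [folklore] -/
theorem isUnit_two_padicInt (hℓ2 : ℓ ≠ 2) : IsUnit (2 : ℤ_[ℓ]) := by
  have h : ¬ (ℓ : ℤ) ∣ 2 := by
    intro hd
    have h' : ℓ ∣ 2 := by exact_mod_cast hd
    have := (Nat.prime_dvd_prime_iff_eq (Fact.out : ℓ.Prime) Nat.prime_two).mp h'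
    exact hℓ2 this
  have := isUnit_intCast_padicInt_of_not_dvd h
  simpa using this

/-- `(d/ℓ) = −1` forces `ℓ ∤ d`. [folklore] -/
theorem not_dvd_of_jacobiSym_eq_neg_one {d : ℤ} (hJ : jacobiSym d ℓ = -1) : ¬ (ℓ : ℤ) ∣ d := by
  intro h
  have hℓ : ℓ.Prime := Fact.out
  have h0 : jacobiSym d ℓ = 0 := by
    rw [jacobiSym.mod_left, Int.emod_eq_zero_of_dvd h, jacobiSym.zero_left hℓ.one_lt]
  rw [h0] at hJ
  exact absurd hJ (by decide)

/-- `(d/ℓ) = −1` makes the residue of `d` in `ℤ_ℓ/ℓ` a non-square (the residue map of `ℤ_ℓ` and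
`PadicInt.toZMod` have the same kernel, and `¬ IsSquare (d : ZMod ℓ)` is Mathlib's
`ZMod.nonsquare_of_jacobiSym_eq_neg_one`). [folklore] -/
theorem not_isSquare_residue_of_jacobiSym_eq_neg_one {d : ℤ} (hJ : jacobiSym d ℓ = -1) :
    ¬ IsSquare (IsLocalRing.residue ℤ_[ℓ] (d : ℤ_[ℓ])) := by
  rintro ⟨r, hr⟩
  obtain ⟨t, rfl⟩ := IsLocalRing.residue_surjective r
  rw [← map_mul, ← sub_eq_zero, ← map_sub, IsLocalRing.residue_eq_zero_iff,
    ← PadicInt.ker_toZMod, RingHom.mem_ker, map_sub, map_mul, sub_eq_zero, map_intCast] at hr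
  exact ZMod.nonsquare_of_jacobiSym_eq_neg_one hJ ⟨PadicInt.toZMod t, hr⟩

end Units

/-! ### The unit twist at an inert odd prime -/

section Inert

variable (W : WeierstrassCurve ℚ) [W.IsElliptic] [W.IsGloballyMinimal]
  (K : Type) [Field K] [NumberField K]
  {Wd : WeierstrassCurve ℚ} [Wd.IsElliptic] [Wd.IsGloballyMinimal] (Cd : VariableChange ℚ)
  (hWd : Cd • W.quadraticTwist (NumberField.discr K : ℚ) = Wd)
  (ℓ : ℕ) [Fact ℓ.Prime] (hℓ2 : ℓ ≠ 2) (hJ : jacobiSym (NumberField.discr K) ℓ = -1)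

include hWd hℓ2 hJ

/-- **`ord_ℓ Δ_min(E^{d}) = ord_ℓ Δ_min(E)` for a twist by an `ℓ`-adic unit `d`, `ℓ` odd**
(`(d/ℓ) = −1` case; the square case is `padicValInt_minimalDiscriminantInt_twist_eq`): the twist
`(E ⊗ ℚ_ℓ)^{(d)}` of the `ℤ_ℓ`-minimal equation `E ⊗ ℚ_ℓ` is again `ℤ_ℓ`-minimal
(`isMinimal_quadraticTwist`, `2 ∈ ℤ_ℓ^×`) with `Δ = d⁶ Δ`, and two minimal equations of `E^{d} ⊗ ℚ_ℓ`
have discriminants of the same valuation (Silverman *AEC* VII.1 Prop. 1.3(b)).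
[cite: SilvermanAEC2009, VII.1 Prop. 1.3(b) and X.5 Cor. 5.4] -/
theorem padicValInt_minimalDiscriminantInt_twist_eq_of_jacobiSym :
    padicValInt ℓ Wd.minimalDiscriminantInt = padicValInt ℓ W.minimalDiscriminantInt := by
  set d : ℤ := NumberField.discr K with hd_def
  have hℓd : ¬ (ℓ : ℤ) ∣ d := not_dvd_of_jacobiSym_eq_neg_one hJ
  have hd0 : d ≠ 0 := by rw [hd_def]; exact NumberField.discr_ne_zero K
  have hD0 : (d : ℚ) ≠ 0 := by exact_mod_cast hd0
  haveI : (W.quadraticTwist (d : ℚ)).IsElliptic := W.isElliptic_quadraticTwist hD0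
  set u : ℤ_[ℓ]ˣ := (isUnit_intCast_padicInt_of_not_dvd hℓd).unit with hu_def
  have hu : (u : ℤ_[ℓ]) = (d : ℤ_[ℓ]) := rfl
  have hu' : algebraMap ℤ_[ℓ] ℚ_[ℓ] (u : ℤ_[ℓ]) = algebraMap ℚ ℚ_[ℓ] (d : ℚ) := by
    rw [hu]; simp
  set X : WeierstrassCurve ℚ_[ℓ] := W.baseChange ℚ_[ℓ] with hX
  set Y : WeierstrassCurve ℚ_[ℓ] := Wd.baseChange ℚ_[ℓ] with hY
  haveI hXmin : X.IsMinimal ℤ_[ℓ] := isMinimal_map_padic_of_isGloballyMinimal W ℓ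
  have hYmin : Y.IsMinimal ℤ_[ℓ] := isMinimal_map_padic_of_isGloballyMinimal Wd ℓ
  set Y' : WeierstrassCurve ℚ_[ℓ] := X.quadraticTwist (algebraMap ℤ_[ℓ] ℚ_[ℓ] (u : ℤ_[ℓ])) with hY'
  have hY'min : Y'.IsMinimal ℤ_[ℓ] := isMinimal_quadraticTwist ℤ_[ℓ] X (isUnit_two_padicInt hℓ2) u
  -- `Y = Cd • Y'`
  have hYY' : Y = Cd.map (algebraMap ℚ ℚ_[ℓ]) • Y' := by
    rw [hY, ← hWd, WeierstrassCurve.VariableChange.baseChange_smul_eq (W.quadraticTwist (d : ℚ)) Cd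
      ℚ_[ℓ], baseChange, map_quadraticTwist, ← hu', hY', hX, baseChange]
  -- equal valuations of the discriminants
  have hmv : Padic.mulValuation Y.Δ = Padic.mulValuation Y'.Δ := by
    rw [hYY']
    exact padicMulValuation_Δ_smul_eq_of_isMinimal Y' _ hY'min (by rw [← hYY']; exact hYmin)
  have hXΔ : X.Δ = (W.minimalDiscriminantInt : ℚ_[ℓ]) := by
    rw [hX, baseChange, map_Δ, ← cast_minimalDiscriminantInt W, map_intCast]
  have hYΔ : Y.Δ = (Wd.minimalDiscriminantInt : ℚ_[ℓ]) := by
    rw [hY, baseChange, map_Δ, ← cast_minimalDiscriminantInt Wd, map_intCast]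
  have hY'Δ : Y'.Δ = ((d ^ 6 * W.minimalDiscriminantInt : ℤ) : ℚ_[ℓ]) := by
    rw [hY', quadraticTwist_Δ, hXΔ, hu]
    push_cast
    simp
  have hX0 : W.minimalDiscriminantInt ≠ 0 := minimalDiscriminantInt_ne_zero W
  have hY0 : Y.Δ ≠ 0 := by
    rw [hYΔ]; exact_mod_cast minimalDiscriminantInt_ne_zero Wd
  have hY'0 : Y'.Δ ≠ 0 := by
    rw [hY'Δ]; exact_mod_cast mul_ne_zero (pow_ne_zero 6 hd0) hX0
  rw [padicMulValuation_apply_of_ne_zero hY0, padicMulValuation_apply_of_ne_zero hY'0,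
    WithZero.exp_inj, neg_inj, hYΔ, hY'Δ, Padic.valuation_intCast, Padic.valuation_intCast] at hmv
  have hmv' : padicValInt ℓ Wd.minimalDiscriminantInt =
      padicValInt ℓ (d ^ 6 * W.minimalDiscriminantInt) := by
    exact_mod_cast hmv
  have h6 : padicValInt ℓ (d ^ 6) = 0 :=
    padicValInt.eq_zero_of_not_dvd fun h ↦ hℓd (Int.Prime.dvd_pow' (Fact.out : ℓ.Prime) h)
  rw [hmv', padicValInt.mul (pow_ne_zero 6 hd0) hX0, h6, zero_add]

/-- **At an odd inert multiplicative prime the two Tamagawa exponents add up to at most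
`ord_p(ord_ℓ Δ_min(E))`.** `W/ℚ` globally minimal, multiplicative at the odd prime `ℓ` with
`(d_K/ℓ) = −1`, `Wd` a globally minimal model of `E^{d_K}`, `p ≥ 5`: `d_K` is a non-square unit of
`ℤ_ℓ`, so exactly one of `E ⊗ ℚ_ℓ`, `E^{d_K} ⊗ ℚ_ℓ` is SPLIT multiplicative (Silverman *AEC* VII.5,
Ex. 10.16 shape; tree `hasSplitMultiplicativeReduction_quadraticTwist_iff`, transported between
minimal equations by `hasSplitMultiplicativeReduction_iff_of_isMinimal_of_eq_smul`); the split one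
has `c_ℓ = ord_ℓ Δ_min(E)` (Kodaira–Néron IV.9.2(d); `localTamagawaNumber_eq_padicValInt_of_split`
and `padicValInt_minimalDiscriminantInt_twist_eq_of_jacobiSym`), the other `0 < c_ℓ ≤ 4 < p`.
This is the cancellation "`c_ℓ(E)·c_ℓ(E^D)` versus `c_w(E/K″) = ord_ℓ Δ`" at a prime `ℓ ∣ N⁻` of
Jetchev–Skinner–Wan 2017 §7.3.1/§7.4.2. [cite: SilvermanATAEC1994, Cor. IV.9.2(d) with (b) (PDF p. 340)]
[cite: SilvermanAEC2009, VII.5 Prop. 5.1(b) and VII.1 Prop. 1.3(b)] -/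
theorem padicValNat_localTamagawaNumber_add_twist_le_of_inert (p : ℕ) [Fact p.Prime] (hp5 : 5 ≤ p)
    (hmult : Mult W ℓ) :
    padicValNat p ((W.baseChange ℚ_[ℓ]).localTamagawaNumber ℤ_[ℓ]) +
        padicValNat p ((Wd.baseChange ℚ_[ℓ]).localTamagawaNumber ℤ_[ℓ]) ≤
      padicValNat p (padicValInt ℓ W.minimalDiscriminantInt) := by
  set d : ℤ := NumberField.discr K with hd_def
  have hℓd : ¬ (ℓ : ℤ) ∣ d := not_dvd_of_jacobiSym_eq_neg_one hJ
  have hd0 : d ≠ 0 := by rw [hd_def]; exact NumberField.discr_ne_zero K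
  have hD0 : (d : ℚ) ≠ 0 := by exact_mod_cast hd0
  haveI : (W.quadraticTwist (d : ℚ)).IsElliptic := W.isElliptic_quadraticTwist hD0
  haveI : (W.baseChange ℚ_[ℓ]).IsElliptic := inferInstanceAs (W.map (algebraMap ℚ ℚ_[ℓ])).IsElliptic
  haveI : (Wd.baseChange ℚ_[ℓ]).IsElliptic := inferInstanceAs (Wd.map (algebraMap ℚ ℚ_[ℓ])).IsElliptic
  haveI := finite_residueField_padicInt ℓ
  set u : ℤ_[ℓ]ˣ := (isUnit_intCast_padicInt_of_not_dvd hℓd).unit with hu_def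
  have hu : (u : ℤ_[ℓ]) = (d : ℤ_[ℓ]) := rfl
  have hu' : algebraMap ℤ_[ℓ] ℚ_[ℓ] (u : ℤ_[ℓ]) = algebraMap ℚ ℚ_[ℓ] (d : ℚ) := by
    rw [hu]; simp
  have hnsq : ¬ IsSquare (IsLocalRing.residue ℤ_[ℓ] (u : ℤ_[ℓ])) := by
    rw [hu]; exact not_isSquare_residue_of_jacobiSym_eq_neg_one hJ
  set X : WeierstrassCurve ℚ_[ℓ] := W.baseChange ℚ_[ℓ] with hX
  set Y : WeierstrassCurve ℚ_[ℓ] := Wd.baseChange ℚ_[ℓ] with hY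
  haveI hXmin : X.IsMinimal ℤ_[ℓ] := isMinimal_map_padic_of_isGloballyMinimal W ℓ
  haveI hYmin : Y.IsMinimal ℤ_[ℓ] := isMinimal_map_padic_of_isGloballyMinimal Wd ℓ
  set Y' : WeierstrassCurve ℚ_[ℓ] := X.quadraticTwist (algebraMap ℤ_[ℓ] ℚ_[ℓ] (u : ℤ_[ℓ])) with hY'
  haveI hY'min : Y'.IsMinimal ℤ_[ℓ] := isMinimal_quadraticTwist ℤ_[ℓ] X (isUnit_two_padicInt hℓ2) u
  have hX0 : X.Δ ≠ 0 := by
    rw [hX, baseChange, map_Δ, ← cast_minimalDiscriminantInt W, map_intCast]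
    exact_mod_cast minimalDiscriminantInt_ne_zero W
  have hY'0 : Y'.Δ ≠ 0 := by
    rw [hY', quadraticTwist_Δ]
    exact mul_ne_zero (pow_ne_zero 6 (by rw [hu']; exact (map_ne_zero _).mpr hD0)) hX0
  -- `Y = Cd • Y'`
  have hYY' : Y = Cd.map (algebraMap ℚ ℚ_[ℓ]) • Y' := by
    rw [hY, ← hWd, WeierstrassCurve.VariableChange.baseChange_smul_eq (W.quadraticTwist (d : ℚ)) Cd
      ℚ_[ℓ], baseChange, map_quadraticTwist, ← hu', hY', hX, baseChange]
  -- the chosen minimal models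
  obtain ⟨C₁, hC₁⟩ : ∃ C : VariableChange ℚ_[ℓ], X.minimal ℤ_[ℓ] = C • X := ⟨_, rfl⟩
  obtain ⟨C₂, hC₂⟩ : ∃ C : VariableChange ℚ_[ℓ], Y.minimal ℤ_[ℓ] = C • Y := ⟨_, rfl⟩
  have hC₂' : Y.minimal ℤ_[ℓ] = (C₂ * Cd.map (algebraMap ℚ ℚ_[ℓ])) • Y' := by
    rw [hC₂, hYY', mul_smul]
  -- `X` is multiplicative; the twist criterion
  have hXmult : X.HasMultiplicativeReduction ℤ_[ℓ] :=
    (hasMultiplicativeReduction_iff_of_isMinimal_of_eq_smul ℤ_[ℓ] hC₁ hX0).mp hmult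
  have hsplit : Y'.HasSplitMultiplicativeReduction ℤ_[ℓ] ↔ ¬ X.HasSplitMultiplicativeReduction ℤ_[ℓ] := by
    rw [hasSplitMultiplicativeReduction_quadraticTwist_iff ℤ_[ℓ] (isUnit_two_padicInt hℓ2) hXmult]
    constructor
    · intro h hXs; exact hnsq (h.mpr hXs)
    · intro h; exact ⟨fun hs ↦ absurd hs hnsq, fun hs ↦ absurd hs h⟩
  have hXs_iff : W.HasSplitMultiplicativeReductionAtPrime ℓ ↔ X.HasSplitMultiplicativeReduction ℤ_[ℓ] :=
    hasSplitMultiplicativeReduction_iff_of_isMinimal_of_eq_smul ℤ_[ℓ] hC₁ hX0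
  have hYs_iff : Wd.HasSplitMultiplicativeReductionAtPrime ℓ ↔ Y'.HasSplitMultiplicativeReduction ℤ_[ℓ] :=
    hasSplitMultiplicativeReduction_iff_of_isMinimal_of_eq_smul ℤ_[ℓ] hC₂' hY'0
  -- the place of `ℤ` above `ℓ`
  obtain ⟨v, hv⟩ : ∃ v : HeightOneSpectrum ℤ, (primesEquiv v : ℕ) = ℓ :=
    ⟨primesEquiv.symm ⟨ℓ, Fact.out⟩, by rw [Equiv.apply_symm_apply]⟩
  have hΔ : padicValInt ℓ Wd.minimalDiscriminantInt = padicValInt ℓ W.minimalDiscriminantInt :=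
    padicValInt_minimalDiscriminantInt_twist_eq_of_jacobiSym W K Cd hWd ℓ hℓ2 hJ
  by_cases hXs : X.HasSplitMultiplicativeReduction ℤ_[ℓ]
  · -- `W` split at `ℓ`, `Wd` non-split
    have hWs : W.HasSplitMultiplicativeReductionAtPrime ℓ := hXs_iff.mpr hXs
    have hWdns : ¬ ((Wd.baseChange ℚ_[ℓ]).minimal ℤ_[ℓ]).HasSplitMultiplicativeReduction ℤ_[ℓ] :=
      fun h ↦ (hsplit.mp (hYs_iff.mp h)) hXs
    have h4 := localTamagawaNumber_padic_le_four ℓ (Wd.baseChange ℚ_[ℓ]) hWdns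
    have hne := localTamagawaNumber_padic_ne_zero_holds ℓ (Wd.baseChange ℚ_[ℓ])
    have h0 : padicValNat p ((Wd.baseChange ℚ_[ℓ]).localTamagawaNumber ℤ_[ℓ]) = 0 := by
      rw [padicValNat.eq_zero_of_not_dvd]
      intro hdvd
      have := Nat.le_of_dvd (Nat.pos_of_ne_zero hne) hdvd
      omega
    rw [h0, add_zero, localTamagawaNumber_eq_padicValInt_of_split W v hv hWs]
  · -- `W` non-split at `ℓ`, `Wd` split
    have hWds : Wd.HasSplitMultiplicativeReductionAtPrime ℓ := hYs_iff.mpr (hsplit.mpr hXs)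
    have hWns : ¬ ((W.baseChange ℚ_[ℓ]).minimal ℤ_[ℓ]).HasSplitMultiplicativeReduction ℤ_[ℓ] :=
      fun h ↦ hXs (hXs_iff.mp h)
    have h4 := localTamagawaNumber_padic_le_four ℓ (W.baseChange ℚ_[ℓ]) hWns
    have hne := localTamagawaNumber_padic_ne_zero_holds ℓ (W.baseChange ℚ_[ℓ])
    have h0 : padicValNat p ((W.baseChange ℚ_[ℓ]).localTamagawaNumber ℤ_[ℓ]) = 0 := by
      rw [padicValNat.eq_zero_of_not_dvd]
      intro hdvd
      have := Nat.le_of_dvd (Nat.pos_of_ne_zero hne) hdvd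
      omega
    rw [h0, zero_add, localTamagawaNumber_eq_padicValInt_of_split Wd v hv hWds, hΔ]

end Inert

end Summit.BirchSwinnertonDyer.Rank1Residual.X11b

end
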